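import Literature.NumberTheory.GaloisRepresentations.WeilGroupOpenFiniteIndex
import Literature.NumberTheory.GaloisRepresentations.LocalGaloisGroupProofs
import HarnessLib

/-!
# A power of Frobenius central modulo the kernel; field subgroups inside kernels

Topic `Literature/NumberTheory/GaloisRepresentations` (companion of `WeilGroup`,
`WeilGroupOpenFiniteIndex`, `LocalWeilDatum*`).  Group theory of the Weil group `W_E` of a
non-archimedean local field behind the first step of Deligne's proof of the uniqueness of the
local constants (*Les constantes des équations fonctionnelles des fonctions L*, Antwerp II (1973),
§4.10; Tate, *Number theoretic background*, Corvallis 1979, (2.2)): **an irreducible continuous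
representation of `W_E` is an unramified twist of a representation with finite image**.  The
analytic half (Schur's lemma and the choice of the twist `ω_s`) is done where representations over
`ℂ` are available; here, for a homomorphism `ρ` of `W_E` into any monoid which is trivial on
`I_E ∩ G_L` for some finite `L/E` (the shape of the continuity condition,
`WeilGroup.IsContinuousRep`, `LocalWeilDatum.exists_inertia_inf_fieldSubgroup_le`):

* `WeilGroup.exists_pow_mem_fieldSubgroup_commute` — for `Φ` of degree `1` some `Φ ^ m`
  (`m ≥ 1`) lies in `W_E ∩ G_L` and `ρ(Φ ^ m)` commutes with all of `ρ(W_E)`: take `m` the index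
  of the normal core `N` of the finite-index subgroup `W_E ∩ G_L`; for `u ∈ I_E` the commutator
  `[Φ ^ m, u]` lies in `N ∩ I_E`, where `ρ` is trivial, and `W_E = Φ^ℤ · I_E`;
* `WeilGroup.forall_mem_fieldSubgroup_inf_degMultiples_eq_one` — if moreover `ρ(Φ ^ m) = 1` then
  `ρ` is trivial on `W_E ∩ G_L ∩ deg⁻¹(mℤ)`, which is a field subgroup
  (`isFieldSubgroup_fieldSubgroup_inf_degMultiples`; so `ker ρ` contains the Weil group of a
  finite separable extension, and `ρ` factors through a finite quotient);
* `WeilGroup.map_zpow_eq_one_of_map_eq_one` (monoid-valued homomorphisms kill `P^ℤ` once they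
  kill `P`).

All proved; no definitions, no named facts.

## Mathlib search

Mathlib (this pin): `Subgroup.normalCore`, `Subgroup.finiteIndex_normalCore`,
`Subgroup.pow_index_mem`, `Commute.map`, `MonoidHom.map_zpow`, used below; no Weil groups.

## References

* P. Deligne, *Les constantes des équations fonctionnelles des fonctions L*, Antwerp II, LNM 349
  (1973), §4.10 (`DeligneAntwerpII1973`).
* J. Tate, *Number theoretic background*, Corvallis 1979, (1.4.1), (2.2) (`Corvallis1979`).
-/

noncomputable section

open Field ValuativeRel
open scoped Pointwise

namespace Literature.NumberTheory.GaloisRepresentations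

/-! ### Field subgroups inside kernels -/

namespace WeilGroup

open LocalWeilDatum GaloisRepresentations.IsNonarchimedeanLocalField AbstractCFT

variable (E : Type*) [Field E] [ValuativeRel E] [TopologicalSpace E] [IsNonarchimedeanLocalField E]

/-- `W_E ∩ G_L ∩ deg⁻¹(mℤ)` is a field subgroup (`L ⊆ E^sep` finite, `m ≥ 1`): the Weil subgroup of
the compositum of `L` with the unramified extension of degree `m`. [folklore] -/
theorem isFieldSubgroup_fieldSubgroup_inf_degMultiples (L : IntermediateField E (AlgebraicClosure E))
    [FiniteDimensional E L] (hLs : L ≤ sepClosure E) {m : ℕ} (hm : 0 < m) :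
    IsFieldSubgroup E (fieldSubgroup E L ⊓ degMultiples (LocalWeilDatum.degHom E) m) :=
  isFieldSubgroup_inf E ⟨L, inferInstance, hLs, rfl⟩ (isFieldSubgroup_degMultiples E m hm)

variable {E}

/-- If a homomorphism on `W_E` kills `P` then it kills every integral power of `P`
(monoid-valued homomorphisms: `ρ P⁻¹ = 1` as `ρ P · ρ P⁻¹ = 1`). [folklore] -/
theorem map_zpow_eq_one_of_map_eq_one {M : Type*} [Monoid M] (ρ : WeilGroup E →* M)
    {P : WeilGroup E} (hP : ρ P = 1) (k : ℤ) : ρ (P ^ k) = 1 := by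
  have hinv : ∀ n : ℕ, ρ ((P ^ n)⁻¹) = 1 := fun n => by
    have h := map_mul ρ (P ^ n) (P ^ n)⁻¹
    rwa [mul_inv_cancel, map_one, map_pow, hP, one_pow, one_mul, eq_comm] at h
  obtain ⟨n, rfl | rfl⟩ := Int.eq_nat_or_neg k
  · rw [zpow_natCast, map_pow, hP, one_pow]
  · rw [zpow_neg, zpow_natCast, hinv]

/-- **A power of Frobenius central modulo the kernel.**  Let `ρ` be a homomorphism on `W_E`
trivial on `I_E ∩ G_L` for a finite `L/E` (e.g. a continuous representation,
`IsContinuousRep.exists_intermediateField`).  Then for any `Φ` of degree `1` there is `m ≥ 1` with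
`Φ ^ m ∈ W_E ∩ G_L` such that `ρ(Φ ^ m)` commutes with every `ρ(w)`: take `m` the index of the
normal core `N` of the finite-index subgroup `W_E ∩ G_L`; then `Φ ^ m ∈ N`, and for `u ∈ I_E` the
commutator `[Φ ^ m, u]` lies in `N ∩ I_E ⊆ G_L ∩ I_E`, where `ρ` is trivial; finally
`W_E = Φ^ℤ · I_E`.  (First step of: an irreducible representation of `W_E` is an unramified twist
of one with finite image.) [cite: DeligneAntwerpII1973, §4.10] -/
theorem exists_pow_mem_fieldSubgroup_commute {M : Type*} [Monoid M] (ρ : WeilGroup E →* M)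
    (L : IntermediateField E (AlgebraicClosure E)) [FiniteDimensional E L]
    (hρ : ∀ u ∈ inertia E ⊓ fieldSubgroup E L, ρ u = 1) {Φ : WeilGroup E} (hΦ : deg Φ = 1) :
    ∃ m : ℕ, 0 < m ∧ Φ ^ m ∈ fieldSubgroup E L ∧ ∀ w : WeilGroup E, Commute (ρ (Φ ^ m)) (ρ w) := by
  haveI := finiteIndex_fieldSubgroup E L
  haveI hIn : (inertia E).Normal := inertia_normal (absInertia_normal_holds E)
  set N := (fieldSubgroup E L).normalCore with hN
  refine ⟨N.index, Nat.pos_of_ne_zero Subgroup.FiniteIndex.index_ne_zero,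
    Subgroup.normalCore_le _ (N.pow_index_mem Φ), fun w => ?_⟩
  set P := Φ ^ N.index with hPdef
  have hPN : P ∈ N := N.pow_index_mem Φ
  -- `ρ P` commutes with `ρ u`, `u ∈ I_E`
  have hcommI : ∀ u ∈ inertia E, Commute (ρ P) (ρ u) := by
    intro u hu
    have hc : P * u * P⁻¹ * u⁻¹ ∈ inertia E ⊓ fieldSubgroup E L := by
      refine ⟨(inertia E).mul_mem (hIn.conj_mem u hu P) ((inertia E).inv_mem hu),
        Subgroup.normalCore_le _ ?_⟩
      have h2 : u * P⁻¹ * u⁻¹ ∈ N := (Subgroup.normalCore_normal _).conj_mem _ (N.inv_mem hPN) u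
      simpa only [mul_assoc] using N.mul_mem hPN h2
    have h1 := hρ _ hc
    have hid : P * u = P * u * P⁻¹ * u⁻¹ * (u * P) := by group
    show ρ P * ρ u = ρ u * ρ P
    rw [← map_mul, hid, map_mul, h1, one_mul, map_mul]
  -- and with `ρ (Φ ^ d)`, `d : ℤ`
  have hcommΦ : ∀ d : ℤ, Commute (ρ P) (ρ (Φ ^ d)) := fun d =>
    (((Commute.refl Φ).pow_left N.index).zpow_right d).map ρ
  -- `w = (w Φ^{-deg w}) Φ^{deg w}` with the first factor in `I_E`
  have hu : w * Φ ^ (-deg w) ∈ inertia E := by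
    rw [← deg_eq_zero_iff_mem_inertia IsFrobPow.mul_holds IsFrobPow.unique_holds,
      deg_mul IsFrobPow.mul_holds IsFrobPow.unique_holds]
    have hz : ∀ z : ℤ, deg (Φ ^ z) = z := fun z =>
      (MonoidHom.map_zpow (WeilGroup.degHom E IsFrobPow.mul_holds IsFrobPow.unique_holds) Φ z
        |> congrArg Multiplicative.toAdd).trans (by simp [hΦ])
    rw [hz, add_neg_cancel]
  have hw : w = (w * Φ ^ (-deg w)) * Φ ^ (deg w) := by group
  rw [hw, map_mul]
  exact (hcommI _ hu).mul_right (hcommΦ _)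

/-- **The kernel of a normalised representation contains a field subgroup.**  With `ρ`, `L`, `Φ`,
`m` as in `exists_pow_mem_fieldSubgroup_commute`, if moreover `ρ (Φ ^ m) = 1` then `ρ` is trivial
on the field subgroup `W_E ∩ G_L ∩ deg⁻¹(mℤ)`: such an element is `(Φ ^ m) ^ k · v` with
`v ∈ I_E ∩ G_L`. [cite: DeligneAntwerpII1973, §4.10] -/
theorem forall_mem_fieldSubgroup_inf_degMultiples_eq_one {M : Type*} [Monoid M] (ρ : WeilGroup E →* M)
    (L : IntermediateField E (AlgebraicClosure E))
    (hρ : ∀ u ∈ inertia E ⊓ fieldSubgroup E L, ρ u = 1) {Φ : WeilGroup E} (hΦ : deg Φ = 1) {m : ℕ}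
    (hm : Φ ^ m ∈ fieldSubgroup E L) (h1 : ρ (Φ ^ m) = 1) :
    ∀ u ∈ fieldSubgroup E L ⊓ degMultiples (LocalWeilDatum.degHom E) m, ρ u = 1 := by
  rintro u ⟨huL, hum⟩
  replace hum : u ∈ degMultiples (LocalWeilDatum.degHom E) m := hum
  rw [mem_degMultiples_iff, degZ_degHom] at hum
  obtain ⟨k, hk⟩ := hum
  have hz : ∀ z : ℤ, deg (Φ ^ z) = z := fun z =>
    (MonoidHom.map_zpow (WeilGroup.degHom E IsFrobPow.mul_holds IsFrobPow.unique_holds) Φ z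
      |> congrArg Multiplicative.toAdd).trans (by simp [hΦ])
  -- `v = (Φ^m)^{-k} u ∈ I_E ∩ G_L`
  have hv : (Φ ^ m) ^ (-k) * u ∈ inertia E ⊓ fieldSubgroup E L := by
    refine Subgroup.mem_inf.mpr ⟨?_, (fieldSubgroup E L).mul_mem (Subgroup.zpow_mem _ hm _) huL⟩
    rw [← deg_eq_zero_iff_mem_inertia IsFrobPow.mul_holds IsFrobPow.unique_holds,
      deg_mul IsFrobPow.mul_holds IsFrobPow.unique_holds, ← zpow_natCast, ← zpow_mul, hz, hk]
    ring
  have hu : u = (Φ ^ m) ^ k * ((Φ ^ m) ^ (-k) * u) := by group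
  rw [hu, map_mul, hρ _ hv, mul_one]
  exact map_zpow_eq_one_of_map_eq_one ρ h1 k

end WeilGroup

end Literature.NumberTheory.GaloisRepresentations

end
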